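import Summits.Ventures.CertifiedManyBodySolver.Rows.HalfFilledTL
import Summits.Ventures.CertifiedManyBodySolver.Observables.StructureFactorsAveraging
import Literature.MathematicalPhysics.QuantumLattice.HubbardGroundStateLatticeCovariance
import Summits.HubbardSuperconductivity.ManyBodyBootstrap.Bounds.Defs

/-!
# Ventures/CertifiedManyBodySolver — Rows/HalfFilledTLWords.lean: the 2D `spin_nn` certificate
# objective, read by name into the M2 nearest-neighbour spin rows

HONEST FRAMING: first certified bounds; not a superconductivity verdict; every number certified or
labelled float.  This file contains DEFINITIONS and PROVED structural theorems only (an operator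
identity, a lattice-symmetry theorem, transports between row predicates); it asserts no bound on any
Hubbard ground state and carries no certificate.

Companion of `Rows/HalfFilledTL.lean` (§2 there: the PER-BOND nearest-neighbour spin rows
`M2.SpinNNRow U lo hi`, `M2.SpinNNLowerRow U u q`, `M2.SpinNNUpperRow U u q`, i.e.
`lo ≤ Re ω(𝐒_0·𝐒_{e₁}) ≤ hi` over the class TLGS(U) of torus-limit half-filled ground states, support
`{0, e₁}`) for the speedrun cell `mbsolver`, M2 seat 4 (thermodynamic-limit statement).  It closes the
gap between those rows and the OBJECT that the two-dimensional correlator certificates bound.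

## The gap, and the two facts that close it

A `certsdp/1` correlator certificate with objective `spin_nn` in `d = 2` bounds the BOND AVERAGE
`V = (1/2)(𝐒_0·𝐒_{e₁} + 𝐒_0·𝐒_{e₂})`, written as 12 normal-ordered words on the support
`nnSupport = {0, e₁, e₂}` in the generators `cNN i σ` (both from
`Summits/HubbardSuperconductivity/ManyBodyBootstrap/Bounds/Defs.lean`, imported here so that
`spinDotNNAvg2` below IS the substrate's objective verbatim: compare the claim nodes
`Summit.HubbardSuperconductivity.ManyBodyBootstrap.Bounds.sdp_corr_TL_hubSQ_w3_U8_R2b4eom_ob5p2_Slo`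
(`λ = +1` words) and `…_Sup` (`λ = −1` words = `spinDotNNAvg2Neg`)).  The typed claim node of such a
certificate is `SquareCorrLowerRow U u q nnSupport spinDotNNAvg2[Neg]` (Statement.lean §S2, exactly
as `Certificates/HubbardChain_n1_spin_nn.lean` does for `d = 1`), which is NOT by name an instance
of `M2.SpinNNLowerRow U u q` (ONE bond, support `{0, e₁}`).  Two facts close it:

* (words, §2) `spinDotNNAvg2_eq`: the 12 literal words ARE `(1/2)(𝐒_0·𝐒_{e₁} + 𝐒_0·𝐒_{e₂})`
  (`spinDotAt_eq_normalOrder`, bond by bond); `spinDotNNAvg2Neg_eq`: the `λ = −1` words are the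
  negative.
* (symmetry, §1) `IsTLGS.expect_spinDotAt_d4`: for every `ω ∈ TLGS(U)`, `U > 0`, and every `γ` in
  the point group `D₄`, `ω(𝐒_{x'}·𝐒_{y'}) = ω(𝐒_x·𝐒_y)` whenever `y' − x' = γ (y − x)`; in particular
  `ω(𝐒_0·𝐒_{e₂}) = ω(𝐒_0·𝐒_{e₁})` (`IsTLGS.expect_spinDotAt_e2_eq`).  Proof: `ω_Λ(𝐒_x·𝐒_y)` is the
  limit of the translation-averaged torus expectations `L⁻² ⟨ψ_L, W_{(y−x) mod L} ψ_L⟩`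
  (`Observables.torusAvgExpectAt_spinDotAt`; `W_r = Σ_u 𝐒_u·𝐒_{u+r}`), `U_γ W_r U_γᴴ = W_{γ r}`
  (`relabel_d4Perm_spinCorrSum`), and THE half-filled ground state of an even torus at `U > 0` has
  `D₄`-invariant expectations (`hubbardTorus_expect_relabel_d4Perm_eq`: Lieb's uniqueness theorem +
  the Lieb–Loss–McCann remark); two limits of eventually equal sequences coincide.

Consequently (§3) `Re ω(spinDotNNAvg2) = Re ω(𝐒_0·𝐒_{e₁})` on TLGS(U) and the literal claim nodes
transport BY NAME: `SpinNNLowerRow.of_literal`, `SpinNNUpperRow.of_literalNeg` (and back: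
`SpinNNLowerRow.literal_iff` — nothing is lost by certifying the bond average), plus the one-call
table cell `SpinNNRow.of_literal_pair` (energy ceiling `M2EnergyUpperRow U u` + the two literal nodes
issued for `u` ⟹ `SpinNNRow U lo (min (−hi') 0)`, Shen–Qiu–Tian sign clip included).

## By-name recipe for the typer (2D `spin_nn`, any `U > 0`)

`node_lo : SquareCorrLowerRow U u E_lo nnSupport M2.spinDotNNAvg2` (`λ = +1` certificate, `E_lo` its
exact dyadic `E_cert`, `u` the energy ceiling it was issued for) and
`node_up : SquareCorrLowerRow U u E_up nnSupport M2.spinDotNNAvg2Neg` (`λ = −1`), together with a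
certified `hE : M2EnergyUpperRow U u` (e.g. `m2_U8_upper_r22_of` of
`Certificates/HubbardSquare_n1_upper_luc.lean`, `u = -34106764425/68719476736` at `U = 8`), give
`M2.SpinNNRow.of_literal_pair hU hE node_lo node_up : M2.SpinNNRow U E_lo (min (-E_up) 0)`.

References: Lieb, PRL 62 (1989) 1201, Theorem 2 (uniqueness of the half-filled ground state);
Lieb–Loss–McCann, J. Math. Phys. 34 (1993) 891, p. 894 (symmetry of the unique ground state);
Shen–Qiu–Tian, PRL 72 (1994) 1280 (sign of `⟨𝐒_x·𝐒_y⟩`); Essler–Frahm–Göhmann–Klümper–Korepin, *The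
one-dimensional Hubbard model* (2005), §2.2.5 (spin operators in fermions); Wang et al. 2024, §III
(certified SDP lower bounds on ground-state correlators); Bratteli–Robinson II §6.2.4 (thermodynamic
limit states).
-/

noncomputable section

namespace Summit.Ventures.CertifiedManyBodySolver

open Literature.MathematicalPhysics.QuantumLattice
open Matrix HubbardWave0 Literature.Probability.LatticeModels FermionSpinMoment ThermodynamicLimit Filter Topology
open Literature.MathematicalPhysics.QuantumLattice.FermionTorus (ofTorusSite)
open Summit.HubbardSuperconductivity.ManyBodyBootstrap.Bounds (nnSupport cNN zero_mem_nnSupport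
  e1_mem_nnSupport e2_mem_nnSupport)
open scoped ComplexOrder BigOperators

namespace M2

/-! ## §1 `D₄` covariance of the summed torus correlator; bond symmetry on TLGS(U) -/

section Symmetry

variable {L : ℕ} [NeZero L]

/-- **`U_γ W_r U_γᴴ = W_{γ r}`**: the point group `D₄` of the square torus permutes the translation-summed
spin correlators `W_r = Σ_u 𝐒_u·𝐒_{u+r}` (`𝐒_u·𝐒_v` is a `D₄` scalar, `γ` is additive on `(ℤ/Lℤ)²`,
re-index the sum by `γ`). [cite: Scalapino1995, §2 (square-lattice point group)] -/
theorem relabel_d4Perm_spinCorrSum (γ : DihedralGroup 4) (r : TorusSite 2 L) :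
    relabel (Orb.d4Perm γ) (Observables.spinCorrSum L r) = Observables.spinCorrSum L (d4Site γ r) := by
  unfold Observables.spinCorrSum
  rw [relabel_sum]
  simp_rw [Observables.relabel_d4Perm_fermionSpinDot, d4Site_add]
  exact Fintype.sum_equiv (d4SitePerm (L := L) γ) _ _ fun x => rfl

/-- **`D₄` invariance of the summed spin correlator in THE half-filled torus ground state**:
`⟨ψ, W_{γ r} ψ⟩ = ⟨ψ, W_r ψ⟩` for the (`L²`-particle) ground state `ψ` of the even `L × L` torus at
`t = 1`, `U > 0` — unique by Lieb's theorem, hence with `D₄`-invariant expectations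
(`hubbardTorus_expect_relabel_d4Perm_eq`). [cite: LiebPRL1989, Theorem 2]
[cite: LiebLossMccann1993, p. 894 (remark after the Theorem)] -/
theorem expect_spinCorrSum_d4Site (hL : Even L) {U : ℝ} (hU : 0 < U)
    {ψ : Fock (Orb (FermionTorus 2 L))}
    (hψ : IsGroundState (hamiltonian (fermionTorusGraph 2 L) 1 U) (L ^ 2) ψ)
    (γ : DihedralGroup 4) (r : TorusSite 2 L) :
    expect (Observables.spinCorrSum L (d4Site γ r)) ψ = expect (Observables.spinCorrSum L r) ψ := by
  rw [← relabel_d4Perm_spinCorrSum γ r]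
  exact hubbardTorus_expect_relabel_d4Perm_eq hL one_ne_zero hU hψ γ _

end Symmetry

/-- **`D₄` symmetry of the window spin correlators on TLGS(U)** (`U > 0`): if the separation `y' − x'`
is the image of `y − x` under an element `γ` of the point group (`d4Vec`), then
`ω_{Λ'}(𝐒_{x'}·𝐒_{y'}) = ω_Λ(𝐒_x·𝐒_y)` for every torus-limit half-filled ground state `ω` (windows
`Λ ∋ x, y`, `Λ' ∋ x', y'` arbitrary).  Both sides are limits along the state's torus sequence of
`L⁻² ⟨ψ_L, W_{(y−x) mod L} ψ_L⟩` resp. `L⁻² ⟨ψ_L, W_{γ((y−x) mod L)} ψ_L⟩`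
(`Observables.torusAvgExpectAt_spinDotAt`, `Torus.proj_d4Vec`), which agree for every large `L`
(`expect_spinCorrSum_d4Site`). [cite: LiebPRL1989, Theorem 2] [cite: BratteliRobinsonII1997, §6.2.4] -/
theorem IsTLGS.expect_spinDotAt_d4 {U : ℝ} (hU : 0 < U) {ω : InfVolFermionState 2} (h : IsTLGS U ω)
    {Λ Λ' : Finset (Site 2)} {x y x' y' : Site 2} (hx : x ∈ Λ) (hy : y ∈ Λ) (hx' : x' ∈ Λ')
    (hy' : y' ∈ Λ') (γ : DihedralGroup 4) (hγ : y' - x' = d4Vec γ (y - x)) :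
    ω.expect Λ' (spinDotAt x' hx' y' hy') = ω.expect Λ (spinDotAt x hx y hy) := by
  obtain ⟨Ls, ψ, hLs, hev, hψ, -, hω⟩ := h
  obtain ⟨L₀, hL₀⟩ := exists_forall_le_injOn_proj Λ
  obtain ⟨L₀', hL₀'⟩ := exists_forall_le_injOn_proj Λ'
  refine tendsto_nhds_unique_of_eventuallyEq (hω Λ' (spinDotAt x' hx' y' hy'))
    (hω Λ (spinDotAt x hx y hy)) ?_
  filter_upwards [hLs.eventually_ge_atTop (max (max L₀ L₀') 1)] with j hj
  have hj₁ : L₀ ≤ Ls j := (le_max_left _ _).trans ((le_max_left _ _).trans hj)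
  have hj₂ : L₀' ≤ Ls j := (le_max_right _ _).trans ((le_max_left _ _).trans hj)
  have hj₃ : 1 ≤ Ls j := (le_max_right _ _).trans hj
  haveI : NeZero (Ls j) := ⟨by omega⟩
  rw [torusAvgExpect_eq, torusAvgExpect_eq,
    Observables.torusAvgExpectAt_spinDotAt (hL₀' _ hj₂) hx' hy',
    Observables.torusAvgExpectAt_spinDotAt (hL₀ _ hj₁) hx hy, hγ, Torus.proj_d4Vec,
    expect_spinCorrSum_d4Site (hev j) hU (hψ j)]

/-- The quarter turn maps `e₁` to `e₂`: `d4Vec (r 1) e₁ = e₂`. [folklore] -/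
theorem d4Vec_r_one_unitVec_zero : d4Vec (DihedralGroup.r 1) (unitVec 0 : Site 2) = unitVec 1 := by
  decide

/-- **Bond symmetry on TLGS(U)**: `ω(𝐒_0·𝐒_{e₂}) = ω(𝐒_0·𝐒_{e₁})` (both bonds read in the window
`nnSupport = {0, e₁, e₂}`), `U > 0`. [cite: LiebPRL1989, Theorem 2] -/
theorem IsTLGS.expect_spinDotAt_e2_eq {U : ℝ} (hU : 0 < U) {ω : InfVolFermionState 2}
    (h : IsTLGS U ω) :
    ω.expect nnSupport (spinDotAt 0 zero_mem_nnSupport (unitVec 1) e2_mem_nnSupport) =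
      ω.expect nnSupport (spinDotAt 0 zero_mem_nnSupport (unitVec 0) e1_mem_nnSupport) :=
  h.expect_spinDotAt_d4 hU _ _ _ _ (DihedralGroup.r 1) (by
    rw [sub_zero, sub_zero, d4Vec_r_one_unitVec_zero])

/-- Isotony: the `e₁` bond read in the window `{0, e₁, e₂}` is the `e₁` bond read in `{0, e₁}`
(`spinNNObs` of `Rows/HalfFilledTL.lean`), for EVERY state `ω`. [cite: BratteliRobinsonII1997, §6.2.4] -/
theorem expect_spinDotAt_e1_eq_spinNNObs (ω : InfVolFermionState 2) :
    ω.expect nnSupport (spinDotAt 0 zero_mem_nnSupport (unitVec 0) e1_mem_nnSupport) =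
      ω.expect ({0, unitVec 0} : Finset (Site 2)) spinNNObs := by
  have hsub : ({0, unitVec 0} : Finset (Site 2)) ⊆ nnSupport :=
    Finset.insert_subset_insert _ (Finset.singleton_subset_iff.2 (Finset.mem_insert_self _ _))
  rw [← ω.compatible hsub spinNNObs, spinNNObs, fermionEmbed_incl_spinDotAt]

/-! ## §2 The literal `spin_nn` objective (12 words) and what it is -/

/-- **The bond-averaged nearest-neighbour spin observable** `V = (1/2)(𝐒_0·𝐒_{e₁} + 𝐒_0·𝐒_{e₂}) ∈ 𝔄_{{0,e₁,e₂}}`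
— the `d = 2` `spin_nn` objective of the correlator certificates (`(1/d) Σ_i 𝐒_0·𝐒_{e_i}`).
[cite: EsslerEtAl2005, §2.2.5 eq. (2.66) and (2.71)–(2.73)] -/
def spinNNAvgObs : FermionOp nnSupport :=
  (1 / 2 : ℂ) • (spinDotAt 0 zero_mem_nnSupport (unitVec 0) e1_mem_nnSupport +
    spinDotAt 0 zero_mem_nnSupport (unitVec 1) e2_mem_nnSupport)

/-- **The literal `λ = +1` objective words** of a 2D `spin_nn` certificate (`Slo` nodes), verbatim in the
substrate's generators `cNN i σ` (`i = 0 ↦ 0`, `1 ↦ e₁`, `2 ↦ e₂`; `σ = 0` is ↑): twelve normal-ordered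
quartic words with coefficients `±1/8, ±1/4`.  Equal to `spinNNAvgObs` (`spinDotNNAvg2_eq`).
[cite: EsslerEtAl2005, §2.2.5 eq. (2.66) and (2.71)–(2.73)] -/
def spinDotNNAvg2 : FermionOp nnSupport :=
  ((1/8 : ℚ) : ℂ) • ((cNN 0 0)ᴴ * (cNN 2 0)ᴴ * cNN 2 0 * cNN 0 0) +
  ((1/4 : ℚ) : ℂ) • ((cNN 0 0)ᴴ * (cNN 2 1)ᴴ * cNN 2 0 * cNN 0 1) +
  ((-1/8 : ℚ) : ℂ) • ((cNN 0 0)ᴴ * (cNN 2 1)ᴴ * cNN 2 1 * cNN 0 0) +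
  ((1/8 : ℚ) : ℂ) • ((cNN 0 0)ᴴ * (cNN 1 0)ᴴ * cNN 1 0 * cNN 0 0) +
  ((1/4 : ℚ) : ℂ) • ((cNN 0 0)ᴴ * (cNN 1 1)ᴴ * cNN 1 0 * cNN 0 1) +
  ((-1/8 : ℚ) : ℂ) • ((cNN 0 0)ᴴ * (cNN 1 1)ᴴ * cNN 1 1 * cNN 0 0) +
  ((-1/8 : ℚ) : ℂ) • ((cNN 0 1)ᴴ * (cNN 2 0)ᴴ * cNN 2 0 * cNN 0 1) +
  ((1/4 : ℚ) : ℂ) • ((cNN 0 1)ᴴ * (cNN 2 0)ᴴ * cNN 2 1 * cNN 0 0) +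
  ((1/8 : ℚ) : ℂ) • ((cNN 0 1)ᴴ * (cNN 2 1)ᴴ * cNN 2 1 * cNN 0 1) +
  ((-1/8 : ℚ) : ℂ) • ((cNN 0 1)ᴴ * (cNN 1 0)ᴴ * cNN 1 0 * cNN 0 1) +
  ((1/4 : ℚ) : ℂ) • ((cNN 0 1)ᴴ * (cNN 1 0)ᴴ * cNN 1 1 * cNN 0 0) +
  ((1/8 : ℚ) : ℂ) • ((cNN 0 1)ᴴ * (cNN 1 1)ᴴ * cNN 1 1 * cNN 0 1)

/-- **The literal `λ = −1` objective words** (`Sup` nodes): the same twelve words with all signs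
flipped; equal to `-spinDotNNAvg2` (`spinDotNNAvg2Neg_eq`).
[cite: EsslerEtAl2005, §2.2.5 eq. (2.66) and (2.71)–(2.73)] -/
def spinDotNNAvg2Neg : FermionOp nnSupport :=
  ((-1/8 : ℚ) : ℂ) • ((cNN 0 0)ᴴ * (cNN 2 0)ᴴ * cNN 2 0 * cNN 0 0) +
  ((-1/4 : ℚ) : ℂ) • ((cNN 0 0)ᴴ * (cNN 2 1)ᴴ * cNN 2 0 * cNN 0 1) +
  ((1/8 : ℚ) : ℂ) • ((cNN 0 0)ᴴ * (cNN 2 1)ᴴ * cNN 2 1 * cNN 0 0) +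
  ((-1/8 : ℚ) : ℂ) • ((cNN 0 0)ᴴ * (cNN 1 0)ᴴ * cNN 1 0 * cNN 0 0) +
  ((-1/4 : ℚ) : ℂ) • ((cNN 0 0)ᴴ * (cNN 1 1)ᴴ * cNN 1 0 * cNN 0 1) +
  ((1/8 : ℚ) : ℂ) • ((cNN 0 0)ᴴ * (cNN 1 1)ᴴ * cNN 1 1 * cNN 0 0) +
  ((1/8 : ℚ) : ℂ) • ((cNN 0 1)ᴴ * (cNN 2 0)ᴴ * cNN 2 0 * cNN 0 1) +
  ((-1/4 : ℚ) : ℂ) • ((cNN 0 1)ᴴ * (cNN 2 0)ᴴ * cNN 2 1 * cNN 0 0) +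
  ((-1/8 : ℚ) : ℂ) • ((cNN 0 1)ᴴ * (cNN 2 1)ᴴ * cNN 2 1 * cNN 0 1) +
  ((1/8 : ℚ) : ℂ) • ((cNN 0 1)ᴴ * (cNN 1 0)ᴴ * cNN 1 0 * cNN 0 1) +
  ((-1/4 : ℚ) : ℂ) • ((cNN 0 1)ᴴ * (cNN 1 0)ᴴ * cNN 1 1 * cNN 0 0) +
  ((-1/8 : ℚ) : ℂ) • ((cNN 0 1)ᴴ * (cNN 1 1)ᴴ * cNN 1 1 * cNN 0 1)

/-- **The literal words ARE the bond average**: `spinDotNNAvg2 = (1/2)(𝐒_0·𝐒_{e₁} + 𝐒_0·𝐒_{e₂})`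
(normal-ordered expansion `spinDotAt_eq_normalOrder` of each bond; `cNN` unfolds to `cAt`).
[cite: EsslerEtAl2005, §2.2.5 eq. (2.66) and (2.71)–(2.73)] -/
theorem spinDotNNAvg2_eq : spinDotNNAvg2 = spinNNAvgObs := by
  have h0e1 : (0 : Site 2) ≠ unitVec 0 := fun h => by simpa using congr_fun h 0
  have h0e2 : (0 : Site 2) ≠ unitVec 1 := fun h => by simpa using congr_fun h 1
  unfold spinNNAvgObs spinDotNNAvg2
  rw [spinDotAt_eq_normalOrder h0e1, spinDotAt_eq_normalOrder h0e2]
  simp only [cNN]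
  push_cast
  module

/-- The `λ = −1` words are the negative of the `λ = +1` words.
[cite: EsslerEtAl2005, §2.2.5 eq. (2.66) and (2.71)–(2.73)] -/
theorem spinDotNNAvg2Neg_eq : spinDotNNAvg2Neg = -spinDotNNAvg2 := by
  unfold spinDotNNAvg2Neg spinDotNNAvg2
  push_cast
  module

/-! ## §3 Transports: literal claim nodes ⟹ the M2 `spin_nn` rows, by name -/

/-- **On TLGS(U) the literal objective has the expectation of ONE bond**:
`ω(spinDotNNAvg2) = ω_{{0,e₁}}(𝐒_0·𝐒_{e₁})` (`U > 0`; words identity + bond symmetry + isotony).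
[cite: LiebPRL1989, Theorem 2] [cite: ShenQiuTian1994, Theorem and eqs. (7)–(9)] -/
theorem IsTLGS.expect_spinDotNNAvg2_eq {U : ℝ} (hU : 0 < U) {ω : InfVolFermionState 2}
    (h : IsTLGS U ω) :
    ω.expect nnSupport spinDotNNAvg2 = ω.expect ({0, unitVec 0} : Finset (Site 2)) spinNNObs := by
  rw [spinDotNNAvg2_eq, spinNNAvgObs, map_smul, map_add, h.expect_spinDotAt_e2_eq hU,
    expect_spinDotAt_e1_eq_spinNNObs, smul_eq_mul]
  ring

/-- Same for the `λ = −1` words: `ω(spinDotNNAvg2Neg) = -ω_{{0,e₁}}(𝐒_0·𝐒_{e₁})` on TLGS(U).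
[cite: LiebPRL1989, Theorem 2] [cite: ShenQiuTian1994, Theorem and eqs. (7)–(9)] -/
theorem IsTLGS.expect_spinDotNNAvg2Neg_eq {U : ℝ} (hU : 0 < U) {ω : InfVolFermionState 2}
    (h : IsTLGS U ω) :
    ω.expect nnSupport spinDotNNAvg2Neg = -ω.expect ({0, unitVec 0} : Finset (Site 2)) spinNNObs := by
  rw [spinDotNNAvg2Neg_eq, map_neg, h.expect_spinDotNNAvg2_eq hU]

/-- **Literal `Slo` node ⟹ `SpinNNLowerRow`**: a certificate node
`SquareCorrLowerRow U u q nnSupport spinDotNNAvg2` (bond average `≥ q` given `e₀(U) ≤ u`) is the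
per-bond row `M2.SpinNNLowerRow U u q`. [cite: WangEtAl2024, §III] [cite: LiebPRL1989, Theorem 2] -/
theorem SpinNNLowerRow.of_literal {U : ℝ} (hU : 0 < U) {u q : ℚ}
    (h : SquareCorrLowerRow U u q nnSupport spinDotNNAvg2) : SpinNNLowerRow U u q := by
  refine squareCorrLowerRow_iff.2 fun ω hω hE => ?_
  have h' := squareCorrLowerRow_iff.1 h ω hω hE
  rwa [hω.expect_spinDotNNAvg2_eq hU] at h'

/-- **Literal `Sup` node ⟹ `SpinNNUpperRow`**: a certificate node
`SquareCorrLowerRow U u q nnSupport spinDotNNAvg2Neg` (`−`bond average `≥ q` given `e₀(U) ≤ u`) is the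
per-bond UPPER row `M2.SpinNNUpperRow U u (−q)`. [cite: WangEtAl2024, §III] [cite: LiebPRL1989, Theorem 2] -/
theorem SpinNNUpperRow.of_literalNeg {U : ℝ} (hU : 0 < U) {u q : ℚ}
    (h : SquareCorrLowerRow U u q nnSupport spinDotNNAvg2Neg) : SpinNNUpperRow U u (-q) := by
  refine squareCorrUpperRow_iff.2 fun ω hω hE => ?_
  have h' := squareCorrLowerRow_iff.1 h ω hω hE
  rw [hω.expect_spinDotNNAvg2Neg_eq hU, Complex.neg_re] at h'
  push_cast
  linarith

/-- Conversely the per-bond row gives back the literal node: **nothing is lost by certifying the bond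
average** (the two predicates are equivalent for `U > 0`). [cite: WangEtAl2024, §III] [cite: LiebPRL1989, Theorem 2] -/
theorem SpinNNLowerRow.literal_iff {U : ℝ} (hU : 0 < U) {u q : ℚ} :
    SquareCorrLowerRow U u q nnSupport spinDotNNAvg2 ↔ SpinNNLowerRow U u q := by
  refine ⟨SpinNNLowerRow.of_literal hU, fun h => squareCorrLowerRow_iff.2 fun ω hω hE => ?_⟩
  rw [hω.expect_spinDotNNAvg2_eq hU]
  exact squareCorrLowerRow_iff.1 h ω hω hE

/-- Upper twin of `SpinNNLowerRow.literal_iff`. [cite: WangEtAl2024, §III] [cite: LiebPRL1989, Theorem 2] -/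
theorem SpinNNUpperRow.literalNeg_iff {U : ℝ} (hU : 0 < U) {u q : ℚ} :
    SquareCorrLowerRow U u q nnSupport spinDotNNAvg2Neg ↔ SpinNNUpperRow U u (-q) := by
  refine ⟨SpinNNUpperRow.of_literalNeg hU, fun h => squareCorrLowerRow_iff.2 fun ω hω hE => ?_⟩
  have h' := squareCorrUpperRow_iff.1 h ω hω hE
  rw [hω.expect_spinDotNNAvg2Neg_eq hU, Complex.neg_re]
  push_cast at h'
  linarith

/-- `spin_nn` instance of `CorrelatorRow.of_lower_upper`: the two certificate-shaped per-bond rows issued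
for an energy ceiling `u` plus a certified `e₀(U) ≤ u` (`M2EnergyUpperRow U u`, Statement.lean) give
the table cell `SpinNNRow U lo hi` over ALL of TLGS(U). [cite: WangEtAl2024, §III] -/
theorem SpinNNRow.of_lower_upper {U : ℝ} {u lo hi : ℚ} (hE : M2EnergyUpperRow U u)
    (hl : SpinNNLowerRow U u lo) (hu : SpinNNUpperRow U u hi) : SpinNNRow U lo hi :=
  CorrelatorRow.of_lower_upper hE hl hu

/-- **The one-call table cell from a literal certificate pair**: energy ceiling `e₀(U) ≤ u`, the
`λ = +1` node with constant `lo` and the `λ = −1` node with constant `hi'` (both issued for `u`) give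
`SpinNNRow U lo (min (−hi') 0)` — `lo ≤ Re ω(𝐒_0·𝐒_{e₁}) ≤ min (−hi') 0` for every `ω ∈ TLGS(U)`
(Shen–Qiu–Tian sign clip included). [cite: WangEtAl2024, §III] [cite: ShenQiuTian1994, Theorem and eqs. (7)–(9)] -/
theorem SpinNNRow.of_literal_pair {U : ℝ} (hU : 0 < U) {u lo hi' : ℚ} (hE : M2EnergyUpperRow U u)
    (hlo : SquareCorrLowerRow U u lo nnSupport spinDotNNAvg2)
    (hup : SquareCorrLowerRow U u hi' nnSupport spinDotNNAvg2Neg) : SpinNNRow U lo (min (-hi') 0) :=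
  (SpinNNRow.of_lower_upper hE (SpinNNLowerRow.of_literal hU hlo)
    (SpinNNUpperRow.of_literalNeg hU hup)).clip hU

/-- The bond-averaged cell equals the per-bond cell: `lo ≤ Re ω(V) ≤ hi` on TLGS(U) iff
`SpinNNRow U lo hi` (`V = spinNNAvgObs`), `U > 0`. [cite: LiebPRL1989, Theorem 2] -/
theorem spinNNAvg_correlatorRow_iff {U : ℝ} (hU : 0 < U) {lo hi : ℚ} :
    CorrelatorRow U nnSupport spinNNAvgObs lo hi ↔ SpinNNRow U lo hi := by
  refine ⟨fun h ω hω => ?_, fun h ω hω => ?_⟩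
  · have h' := h ω hω
    rwa [← spinDotNNAvg2_eq, hω.expect_spinDotNNAvg2_eq hU] at h'
  · have h' := h ω hω
    rwa [← spinDotNNAvg2_eq, hω.expect_spinDotNNAvg2_eq hU]

end M2

end Summit.Ventures.CertifiedManyBodySolver

end
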